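import Literature.MathematicalPhysics.QuantumLattice.HubbardParityGapCeiling
import HarnessLib

/-!
# Parity gap × momentum smearing ≤ coupling × doublon deficit

Topic `MathematicalPhysics/QuantumLattice` (family `hubbard`); proof-only operator bookkeeping and
one variational identity, written for route `HubbardSuperconductivity/ParityGapRigidity` (crux
`GappedWindow`, stmt-HubbardSuperconductivity-2196, and its kill criterion `NoUniformParityGap`,
stmt-…-2198), refining the a-priori parity-gap ceiling of `HubbardParityGapCeiling.lean`.

Setting: `H = hubbardTorus 2 L 1 U` on the torus `(ℤ/Lℤ)²` (`L ≥ 3`, ANY real `U`), a unit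
vector `ψ` of the sector `(2n, S^z = 0)` with `Hψ = Eψ`, the Bloch modes `c_{k↑}`
(`momentumAnnihilation k 0`) with occupations `n_k = ‖c_{k↑}ψ‖² ∈ [0, 1]`, and the DRESSED mode
`T_k = Σ_z L⁻¹χ_k(z) n_{z↓} c†_{z↑}` of `HubbardMomentumModeCommutators` (`[H, c†_{k↑}] =
ε_L(k) c†_{k↑} + U T_k`).

* `momentumAnnihilation_mul_dressed_add` — the mixed anticommutator is a c-number on sectors:
  `c_{k↑} T_k + T_k c_{k↑} = L⁻² Σ_z n_{z↓}`;
* `sum_dressed_mul_momentumAnnihilation` — completeness: `Σ_k T_k c_{k↑} = Σ_z n_{z↑} n_{z↓}`,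
  the doublon operator;
* `parityGap_mul_occ_le_mode` — **the mode identity**: with `β_k = Re⟨ψ, T_k c_{k↑} ψ⟩`,
  `(E(2n+1) + E(2n-1) - 2E) · n_k (1 - n_k) ≤ U · (n n_k / L² - β_k)`
  (add an electron with `c†_{k↑}`, remove one with `c_{k↑}`: the kinetic terms `±ε_L(k)` cancel,
  the two interaction terms are `U Re⟨ψ, c_{k↑}T_kψ⟩` and `-U Re⟨ψ, T_k c_{k↑}ψ⟩`, and their sum is
  fixed by the anticommutator: `Re⟨c_{k↑}T_k⟩ + Re⟨T_k c_{k↑}⟩ = n/L²`);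
  `parityGap_le_mode` — the quotient form at a partially occupied mode;
* `parityGap_mul_smearing_le` — **summed over all modes**:
  `(E(2n+1) + E(2n-1) - 2E) · Σ_k n_k(1 - n_k) ≤ U · (n²/L² - Re⟨ψ, Σ_z n_{z↑}n_{z↓} ψ⟩)`,
  "parity gap × momentum smearing ≤ coupling × doublon deficit" (`n²/L²` is the uncorrelated
  doublon number `N_↑N_↓/|Λ|`); `parityGap_mul_smearing_le_of_isGroundStateInSector` — the same
  for a sector ground state, with `E = E₀(2n, S^z = 0)` so that the first factor is the
  Matveev–Larkin parity gap of the route's items.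

Reading.  At `U = 0` the right side vanishes (Wick: `β_k = n n_k/L²`), recovering `PG ≤ 0` at any
partially occupied free mode.  For a repulsive ground state the doublon deficit is what permits a
positive parity gap, and one-particle trial states cannot see beyond first order in `U`: an
`O(U²)` ceiling would need `k`-resolved control of `β_k - n n_k/L²`, a ground-state correlation.
A uniform parity gap `2Δ` in a window forces `2Δ · Σ_k n_k(1-n_k) ≤ U · (n²/L² - ⟨D⟩)` in every
sector ground state (corollaries in `Summits/…/Theorems/ParityGapRigidityDoublonDeficit.lean`).

Everything is proved; no definitions, no named facts.  Sources: H. Tasaki, *Physics and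
Mathematics of Quantum Many-Body Systems* (2020) §2.1 (variational principle), §9.3 (Hubbard
commutators); O. Bratteli, D. W. Robinson, *Operator Algebras and QSM 2* §5.2.1 (CAR);
K. A. Matveev, A. I. Larkin, PRL 78 (1997) 3749 (parity gap).  Folklore finite-dimensional
statements; the tree holds no printed counterpart of the summed identity.

## Mathlib / tree search

Tree (REUSED): `hubbardTorus_commutator_momentumCreation`, `hubbardTorus_commutator_momentumAnnihilation`,
`annihilation_mul_number_of_ne`, `annihilation_mul_creation_add_torus`, `torusChar_mul_conj`,
`torusFourierWeight_mul_self`, `sum_torusFourierWeight_mul_torusChar_mul_conj`, `numberAt_commute`,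
`sum_numberOp_mulVec_apply`, `mem_szSector_two_mul_zero_iff`, `sum_re_expect_momentumNumber_up`,
`star_dotProduct_momentumNumber_mulVec`, `normSq_momentumCreation_add_normSq_momentumAnnihilation`,
`isNParticle_momentumCreation_mulVec`, `isNParticle_momentumAnnihilation_mulVec`,
`LiebThm1.groundEnergy_mul_norm_le`, `star_mulVec_dotProduct`, `norm_toLp_sq`.
Mathlib: `Matrix.star_dotProduct`, `Finset.sum_comm`, `Finset.sum_ite_eq`.
-/

noncomputable section

namespace Literature.MathematicalPhysics.QuantumLattice

open Matrix Finset HubbardWave0 ThermodynamicLimit Literature.Probability.LatticeModels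
open scoped ComplexOrder ComplexConjugate Matrix.Norms.L2Operator InnerProductSpace

/-! ### Two small pieces of bookkeeping -/

section Bookkeeping

/-- `Re ⟨ψ, Aᴴ ψ⟩ = Re ⟨ψ, A ψ⟩` for every square matrix `A` (the two numbers are complex
conjugate). Bratteli–Robinson II §2.1. [folklore] -/
theorem re_star_dotProduct_conjTranspose_mulVec {m : Type*} [Fintype m] (A : Matrix m m ℂ)
    (ψ : m → ℂ) : (star ψ ⬝ᵥ (Aᴴ *ᵥ ψ)).re = (star ψ ⬝ᵥ (A *ᵥ ψ)).re := by
  have h : star ψ ⬝ᵥ (Aᴴ *ᵥ ψ) = star (star ψ ⬝ᵥ (A *ᵥ ψ)) := by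
    rw [← star_mulVec_dotProduct, Matrix.star_dotProduct]
  rw [h, Complex.star_def, Complex.conj_re]

/-- **On Lieb's sector `(a, b)` the down-spin number operator acts as the scalar `b`**:
`(Σ_z n_{z↓}) ψ = b ψ`. Lieb, PRL 62 (1989) 1201, eq. (2). [folklore] -/
theorem sum_numberOp_down_mulVec_of_isInSector {Λ : Type*} [LinearOrder Λ] [Fintype Λ] {a b : ℕ}
    {ψ : Fock (Orb Λ)} (hψ : IsInSector a b ψ) :
    (∑ z : Λ, numberOp z 1) *ᵥ ψ = (b : ℂ) • ψ := by
  ext s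
  rw [sum_numberOp_mulVec_apply, Pi.smul_apply, smul_eq_mul]
  by_cases hs : ψ s = 0
  · simp [hs]
  · have h := not_imp_comm.1 (hψ s) hs
    have hdown : ∀ inst : DecidablePred fun x : Λ => orb x 1 ∈ s,
        (@Finset.filter _ (fun x => orb x 1 ∈ s) inst Finset.univ).card = b := by
      intro inst; rw [← h.2]; congr 1; ext x; simp [downPart]
    rw [hdown]

end Bookkeeping

/-! ### Operator identities for the dressed mode `T_k = Σ_z L⁻¹χ_k(z) n_{z↓} c†_{z↑}` -/

section Dressed

variable {L : ℕ} [NeZero L]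

/-- **The mixed anticommutator of a Bloch mode with its dressed partner is a c-number on sectors**:
`c_{k↑} T_k + T_k c_{k↑} = L⁻² Σ_z n_{z↓}` for `T_k = Σ_z L⁻¹χ_k(z) n_{z↓} c†_{z↑}`
(`n_{z↓}` commutes with the `↑` operators, `{c_{y↑}, c†_{z↑}} = δ_{yz}`, `|L⁻¹χ_k(z)|² = L⁻²`).
Bratteli–Robinson II §5.2.1. [folklore] -/
theorem momentumAnnihilation_mul_dressed_add (k : TorusSite 2 L) :
    momentumAnnihilation k 0 *
        (∑ z : FermionTorus 2 L, (torusFourierWeight 2 L * torusChar k z.toTorusSite) •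
          (numberOp z 1 * creation (orb z 0))) +
      (∑ z : FermionTorus 2 L, (torusFourierWeight 2 L * torusChar k z.toTorusSite) •
          (numberOp z 1 * creation (orb z 0))) * momentumAnnihilation k 0 =
      ((L : ℂ) ^ 2)⁻¹ • ∑ z : FermionTorus 2 L, numberOp z 1 := by
  unfold momentumAnnihilation
  rw [Finset.sum_mul_sum, Finset.sum_mul_sum]
  conv_lhs => arg 1; rw [Finset.sum_comm]
  rw [← Finset.sum_add_distrib, Finset.smul_sum]
  refine Finset.sum_congr rfl fun z _ => ?_
  rw [← Finset.sum_add_distrib]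
  have hterm : ∀ y : FermionTorus 2 L,
      (torusFourierWeight 2 L * conj (torusChar k y.toTorusSite)) • annihilation (orb y 0) *
          ((torusFourierWeight 2 L * torusChar k z.toTorusSite) • (numberOp z 1 * creation (orb z 0))) +
        (torusFourierWeight 2 L * torusChar k z.toTorusSite) • (numberOp z 1 * creation (orb z 0)) *
          ((torusFourierWeight 2 L * conj (torusChar k y.toTorusSite)) • annihilation (orb y 0)) =
      if y = z then ((L : ℂ) ^ 2)⁻¹ • numberOp z 1 else 0 := by
    intro y
    rw [smul_mul_smul_comm, smul_mul_smul_comm,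
      mul_comm (torusFourierWeight 2 L * torusChar k z.toTorusSite)
        (torusFourierWeight 2 L * conj (torusChar k y.toTorusSite)), ← smul_add]
    have hne : orb z 1 ≠ orb y 0 := by simp
    have hcomm : annihilation (orb y 0) * numberOp z 1 = numberOp z 1 * annihilation (orb y 0) :=
      annihilation_mul_number_of_ne hne
    have hop : annihilation (orb y 0) * (numberOp z 1 * creation (orb z 0)) +
        numberOp z 1 * creation (orb z 0) * annihilation (orb y 0) =
        numberOp z 1 * (annihilation (orb y 0) * creation (orb z 0) +
          creation (orb z 0) * annihilation (orb y 0)) := by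
      rw [← mul_assoc, hcomm, mul_assoc, mul_assoc, ← mul_add]
    rw [hop, annihilation_mul_creation_add_torus]
    by_cases hyz : y = z
    · subst hyz
      rw [if_pos rfl, if_pos rfl, mul_one]
      congr 1
      calc torusFourierWeight 2 L * conj (torusChar k y.toTorusSite) *
            (torusFourierWeight 2 L * torusChar k y.toTorusSite)
          = torusFourierWeight 2 L * torusFourierWeight 2 L *
              (torusChar k y.toTorusSite * conj (torusChar k y.toTorusSite)) := by ring
        _ = ((L : ℂ) ^ 2)⁻¹ := by rw [torusChar_mul_conj, mul_one, torusFourierWeight_mul_self]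
    · have hne' : orb y 0 ≠ orb z 0 := fun h => hyz (orb_eq_orb_iff.1 h).1
      rw [if_neg hne', mul_zero, smul_zero, if_neg hyz]
  simp only [hterm, Finset.sum_ite_eq', Finset.mem_univ, if_true]

/-- **Completeness turns the dressed modes into the doublon operator**:
`Σ_k T_k c_{k↑} = Σ_z n_{z↑} n_{z↓}` (`Σ_k L⁻¹χ_k(z) · L⁻¹conj χ_k(y) = δ_{zy}` and
`n_{z↓} c†_{z↑} c_{z↑} = n_{z↑} n_{z↓}`). Bratteli–Robinson II §5.2.1; Friedli–Velenik (2017) §10.4.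
[folklore] -/
theorem sum_dressed_mul_momentumAnnihilation :
    ∑ k : TorusSite 2 L, (∑ z : FermionTorus 2 L, (torusFourierWeight 2 L * torusChar k z.toTorusSite) •
          (numberOp z 1 * creation (orb z 0))) * momentumAnnihilation k 0 =
      ∑ z : FermionTorus 2 L, numberOp z 0 * numberOp z 1 := by
  have hk : ∀ k : TorusSite 2 L, (∑ z : FermionTorus 2 L,
        (torusFourierWeight 2 L * torusChar k z.toTorusSite) • (numberOp z 1 * creation (orb z 0))) *
          momentumAnnihilation k 0 =
      ∑ z : FermionTorus 2 L, ∑ y : FermionTorus 2 L,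
        (torusFourierWeight 2 L * torusChar k z.toTorusSite *
          (torusFourierWeight 2 L * conj (torusChar k y.toTorusSite))) •
          (numberOp z 1 * creation (orb z 0) * annihilation (orb y 0)) := by
    intro k
    unfold momentumAnnihilation
    rw [Finset.sum_mul_sum]
    refine Finset.sum_congr rfl fun z _ => Finset.sum_congr rfl fun y _ => ?_
    rw [smul_mul_smul_comm]
  simp_rw [hk]
  rw [Finset.sum_comm]
  refine Finset.sum_congr rfl fun z _ => ?_
  rw [Finset.sum_comm]
  simp_rw [← Finset.sum_smul, sum_torusFourierWeight_mul_torusChar_mul_conj, ite_smul, one_smul,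
    zero_smul, Finset.sum_ite_eq, Finset.mem_univ, if_true]
  have hcomm : numberOp z 1 * numberOp z 0 = numberOp z 0 * numberOp z 1 :=
    (numberAt_commute (orb z 1) (orb z 0)).eq
  rw [mul_assoc, ← hcomm]
  rfl

end Dressed

/-! ### The mode identity and its sum -/

section ModeIdentity

variable {L : ℕ} [NeZero L]

/-- **The mode identity behind the parity-gap ceiling.** Let `H = hubbardTorus 2 L 1 U` (`L ≥ 3`,
any real `U`), `ψ` a unit vector of the sector `(2n, S^z = 0)` with `Hψ = Eψ`, `k` a Bloch
momentum, `n_k = ‖c_{k↑}ψ‖²` and `β_k = Re ⟨ψ, T_k c_{k↑} ψ⟩` with the dressed mode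
`T_k = Σ_z L⁻¹χ_k(z) n_{z↓} c†_{z↑}`.  Then
`(E(2n+1) + E(2n-1) - 2E) · n_k (1 - n_k) ≤ U · (n·n_k/L² - β_k)`.
Proof: the trial states `c†_{k↑}ψ` and `c_{k↑}ψ` have `Re⟨φ, Hφ⟩ = (E + ε_L(k))(1 - n_k) +
U Re⟨ψ, c_{k↑}T_kψ⟩` and `(E - ε_L(k)) n_k - U β_k` exactly (`[H, c†_k] = ε_k c†_k + U T_k` and
its adjoint); multiply the two variational inequalities by `n_k` and `1 - n_k` and add — the
kinetic terms cancel and `Re⟨c_{k↑}T_k⟩ + β_k = n/L²` by `momentumAnnihilation_mul_dressed_add`.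
Tasaki (2020) §2.1, §9.3. [folklore] -/
theorem parityGap_mul_occ_le_mode (hL : 3 ≤ L) (U : ℝ) {n : ℕ}
    {ψ : Fock (Orb (FermionTorus 2 L))} (hmem : ψ ∈ szSector (Λ := FermionTorus 2 L) (2 * n) 0)
    (h1 : star ψ ⬝ᵥ ψ = 1) {E : ℝ} (hE : hubbardTorus 2 L 1 U *ᵥ ψ = (E : ℂ) • ψ)
    (k : TorusSite 2 L) :
    (groundEnergy (hubbardTorus 2 L 1 U) (2 * n + 1) + groundEnergy (hubbardTorus 2 L 1 U) (2 * n - 1) -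
          2 * E) *
        ((star (momentumAnnihilation k 0 *ᵥ ψ) ⬝ᵥ (momentumAnnihilation k 0 *ᵥ ψ)).re *
          (1 - (star (momentumAnnihilation k 0 *ᵥ ψ) ⬝ᵥ (momentumAnnihilation k 0 *ᵥ ψ)).re)) ≤
      U * ((n : ℝ) / (L : ℝ) ^ 2 *
          (star (momentumAnnihilation k 0 *ᵥ ψ) ⬝ᵥ (momentumAnnihilation k 0 *ᵥ ψ)).re -
        (star ψ ⬝ᵥ (((∑ z : FermionTorus 2 L, (torusFourierWeight 2 L * torusChar k z.toTorusSite) •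
            (numberOp z 1 * creation (orb z 0))) * momentumAnnihilation k 0) *ᵥ ψ)).re) := by
  set H := hubbardTorus 2 L 1 U with hH
  set T : Matrix (Finset (Orb (FermionTorus 2 L))) (Finset (Orb (FermionTorus 2 L))) ℂ :=
    ∑ z : FermionTorus 2 L, (torusFourierWeight 2 L * torusChar k z.toTorusSite) •
      (numberOp z 1 * creation (orb z 0)) with hT
  set φ := momentumCreation k 0 *ᵥ ψ with hφ
  set χ := momentumAnnihilation k 0 *ᵥ ψ with hχ
  set occ : ℝ := (star χ ⬝ᵥ χ).re with hocc
  set β : ℝ := (star ψ ⬝ᵥ ((T * momentumAnnihilation k 0) *ᵥ ψ)).re with hβ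
  set α : ℝ := (star ψ ⬝ᵥ ((momentumAnnihilation k 0 * T) *ᵥ ψ)).re with hα
  have hNP : IsNParticle (2 * n) ψ := ((mem_szSector_iff _ _ _).1 hmem).1
  have hsec : IsInSector n n ψ := (mem_szSector_two_mul_zero_iff n ψ).1 hmem
  -- norms of the two trial states
  have hφn : (star φ ⬝ᵥ φ).re = 1 - occ := by
    have h := normSq_momentumCreation_add_normSq_momentumAnnihilation k ψ
    rw [h1, Complex.one_re] at h
    rw [hocc]
    linarith
  have hocc0 : 0 ≤ occ := by rw [hocc, ← norm_toLp_sq]; positivity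
  have hocc1 : occ ≤ 1 := by
    have h0 : 0 ≤ (star φ ⬝ᵥ φ).re := by rw [← norm_toLp_sq]; positivity
    linarith
  -- the two commutators
  have hcommC := hubbardTorus_commutator_momentumCreation hL U k
  have hcommA := hubbardTorus_commutator_momentumAnnihilation hL U k
  rw [← hH, ← hT] at hcommC hcommA
  -- the two splits `Hφ = (E+ε)φ + U Tψ`, `Hχ = (E-ε)χ - U Tᴴψ`
  have hsplitC : H *ᵥ φ = (((E + torusBand L k : ℝ)) : ℂ) • φ + (U : ℂ) • (T *ᵥ ψ) := by
    have hmul : H * momentumCreation k 0 =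
        momentumCreation k 0 * H + (((torusBand L k : ℝ) : ℂ) • momentumCreation k 0 + (U : ℂ) • T) :=
      (sub_eq_iff_eq_add'.1 hcommC)
    rw [hφ, mulVec_mulVec, hmul, add_mulVec, add_mulVec, ← mulVec_mulVec, hE, mulVec_smul, smul_mulVec,
      smul_mulVec, Complex.ofReal_add, add_smul]
    abel
  have hsplitA : H *ᵥ χ = (((E - torusBand L k : ℝ)) : ℂ) • χ + (-(U : ℂ)) • (Tᴴ *ᵥ ψ) := by
    have hmul : H * momentumAnnihilation k 0 =
        momentumAnnihilation k 0 * H + (-(((torusBand L k : ℝ) : ℂ) • momentumAnnihilation k 0) -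
          (U : ℂ) • Tᴴ) :=
      (sub_eq_iff_eq_add'.1 hcommA)
    rw [hχ, mulVec_mulVec, hmul, add_mulVec, sub_mulVec, neg_mulVec, ← mulVec_mulVec, hE, mulVec_smul,
      smul_mulVec, smul_mulVec, Complex.ofReal_sub, sub_smul, neg_smul]
    abel
  -- exact Rayleigh quotients
  have hexpC : (expect H φ).re = (E + torusBand L k) * (star φ ⬝ᵥ φ).re + U * (star φ ⬝ᵥ (T *ᵥ ψ)).re := by
    rw [expect, hsplitC, dotProduct_add, dotProduct_smul, dotProduct_smul, smul_eq_mul, smul_eq_mul,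
      Complex.add_re, Complex.re_ofReal_mul, Complex.re_ofReal_mul]
  have hexpA : (expect H χ).re = (E - torusBand L k) * (star χ ⬝ᵥ χ).re - U * (star χ ⬝ᵥ (Tᴴ *ᵥ ψ)).re := by
    rw [expect, hsplitA, dotProduct_add, dotProduct_smul, dotProduct_smul, smul_eq_mul, smul_eq_mul,
      Complex.add_re, Complex.re_ofReal_mul, neg_mul, Complex.neg_re, Complex.re_ofReal_mul]
    ring
  -- the cross terms in terms of `α = Re⟨ψ, c_k T ψ⟩` and `β = Re⟨ψ, T c_k ψ⟩`
  have hcrossC : (star φ ⬝ᵥ (T *ᵥ ψ)).re = α := by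
    rw [hα, hφ, star_mulVec_dotProduct, momentumCreation_conjTranspose, mulVec_mulVec]
  have hcrossA : (star χ ⬝ᵥ (Tᴴ *ᵥ ψ)).re = β := by
    rw [hβ, hχ, star_mulVec_dotProduct, momentumAnnihilation_conjTranspose, mulVec_mulVec]
    have hadj : momentumCreation k 0 * Tᴴ = (T * momentumAnnihilation k 0)ᴴ := by
      rw [conjTranspose_mul, momentumAnnihilation_conjTranspose]
    rw [hadj]
    exact re_star_dotProduct_conjTranspose_mulVec _ _
  -- the anticommutator fixes `α + β = n / L²`
  have hanti : α + β = (n : ℝ) / (L : ℝ) ^ 2 := by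
    have hop := momentumAnnihilation_mul_dressed_add k
    rw [← hT] at hop
    have hv : (momentumAnnihilation k 0 * T + T * momentumAnnihilation k 0) *ᵥ ψ =
        (((L : ℂ) ^ 2)⁻¹ * (n : ℂ)) • ψ := by
      rw [hop, smul_mulVec, sum_numberOp_down_mulVec_of_isInSector hsec, smul_smul]
    have h := congrArg (fun v => (star ψ ⬝ᵥ v).re) hv
    simp only [add_mulVec, dotProduct_add, Complex.add_re, dotProduct_smul, smul_eq_mul] at h
    rw [h1, mul_one] at h
    have hc : (((L : ℂ) ^ 2)⁻¹ * (n : ℂ)) = (((n : ℝ) / (L : ℝ) ^ 2 : ℝ) : ℂ) := by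
      push_cast
      ring
    rw [hc, Complex.ofReal_re] at h
    rw [hα, hβ]
    exact h
  -- the two variational inequalities
  have hvarC : groundEnergy H (2 * n + 1) * (star φ ⬝ᵥ φ).re ≤ (expect H φ).re :=
    LiebThm1.groundEnergy_mul_norm_le H (isNParticle_momentumCreation_mulVec k hNP)
  have hvarA : groundEnergy H (2 * n - 1) * (star χ ⬝ᵥ χ).re ≤ (expect H χ).re :=
    LiebThm1.groundEnergy_mul_norm_le H (isNParticle_momentumAnnihilation_mulVec k hNP)
  rw [hexpC, hcrossC, hφn] at hvarC
  rw [hexpA, hcrossA] at hvarA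
  -- hvarC : E₊ (1 - occ) ≤ (E + ε)(1 - occ) + U α ;  hvarA : E₋ occ ≤ (E - ε) occ - U β
  have hαβ : α = (n : ℝ) / (L : ℝ) ^ 2 - β := by linarith
  rw [hαβ] at hvarC
  have hA := mul_le_mul_of_nonneg_left hvarC hocc0
  have hB := mul_le_mul_of_nonneg_left hvarA (sub_nonneg.2 hocc1)
  -- goal: (E₊ + E₋ - 2E) occ (1 - occ) ≤ U (n/L² occ - β)
  show (groundEnergy H (2 * n + 1) + groundEnergy H (2 * n - 1) - 2 * E) * (occ * (1 - occ)) ≤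
    U * ((n : ℝ) / (L : ℝ) ^ 2 * occ - β)
  nlinarith [hA, hB]

/-- **Quotient form at a partially occupied mode**: with the data of `parityGap_mul_occ_le_mode`
and `0 < n_k < 1`,
`E(2n+1) + E(2n-1) - 2E ≤ U · (n·n_k/L² - β_k) / (n_k (1 - n_k))`.
At `U = 0` (or whenever `β_k ≥ n n_k/L²`, the Wick value) the parity gap about `E` is `≤ 0`.
Tasaki (2020) §2.1, §9.3. [folklore] -/
theorem parityGap_le_mode (hL : 3 ≤ L) (U : ℝ) {n : ℕ}
    {ψ : Fock (Orb (FermionTorus 2 L))} (hmem : ψ ∈ szSector (Λ := FermionTorus 2 L) (2 * n) 0)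
    (h1 : star ψ ⬝ᵥ ψ = 1) {E : ℝ} (hE : hubbardTorus 2 L 1 U *ᵥ ψ = (E : ℂ) • ψ)
    (k : TorusSite 2 L)
    (hk0 : 0 < (star (momentumAnnihilation k 0 *ᵥ ψ) ⬝ᵥ (momentumAnnihilation k 0 *ᵥ ψ)).re)
    (hk1 : (star (momentumAnnihilation k 0 *ᵥ ψ) ⬝ᵥ (momentumAnnihilation k 0 *ᵥ ψ)).re < 1) :
    groundEnergy (hubbardTorus 2 L 1 U) (2 * n + 1) + groundEnergy (hubbardTorus 2 L 1 U) (2 * n - 1) -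
        2 * E ≤
      U * ((n : ℝ) / (L : ℝ) ^ 2 *
          (star (momentumAnnihilation k 0 *ᵥ ψ) ⬝ᵥ (momentumAnnihilation k 0 *ᵥ ψ)).re -
        (star ψ ⬝ᵥ (((∑ z : FermionTorus 2 L, (torusFourierWeight 2 L * torusChar k z.toTorusSite) •
            (numberOp z 1 * creation (orb z 0))) * momentumAnnihilation k 0) *ᵥ ψ)).re) /
        ((star (momentumAnnihilation k 0 *ᵥ ψ) ⬝ᵥ (momentumAnnihilation k 0 *ᵥ ψ)).re *
          (1 - (star (momentumAnnihilation k 0 *ᵥ ψ) ⬝ᵥ (momentumAnnihilation k 0 *ᵥ ψ)).re)) := by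
  have h := parityGap_mul_occ_le_mode hL U hmem h1 hE k
  have hpos : 0 < (star (momentumAnnihilation k 0 *ᵥ ψ) ⬝ᵥ (momentumAnnihilation k 0 *ᵥ ψ)).re *
      (1 - (star (momentumAnnihilation k 0 *ᵥ ψ) ⬝ᵥ (momentumAnnihilation k 0 *ᵥ ψ)).re) :=
    mul_pos hk0 (by linarith)
  rwa [le_div_iff₀ hpos]

/-- **Parity gap × momentum smearing ≤ coupling × doublon deficit.** Let `H = hubbardTorus 2 L 1 U`
(`L ≥ 3`, any real `U`) and `ψ` a unit vector of the sector `(2n, S^z = 0)` with `Hψ = Eψ`.  Then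
`(E(2n+1) + E(2n-1) - 2E) · Σ_k n_k(1 - n_k) ≤ U · (n²/L² - Re⟨ψ, Σ_z n_{z↑}n_{z↓} ψ⟩)`,
where `n_k = ‖c_{k↑}ψ‖²` are the Bloch occupations (sum of `parityGap_mul_occ_le_mode` over all
momenta: `Σ_k n_k = n`, and `Σ_k T_k c_{k↑}` is the doublon operator by
`sum_dressed_mul_momentumAnnihilation`). Tasaki (2020) §2.1, §9.3; Matveev–Larkin (1997). [folklore] -/
theorem parityGap_mul_smearing_le (hL : 3 ≤ L) (U : ℝ) {n : ℕ}
    {ψ : Fock (Orb (FermionTorus 2 L))} (hmem : ψ ∈ szSector (Λ := FermionTorus 2 L) (2 * n) 0)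
    (h1 : star ψ ⬝ᵥ ψ = 1) {E : ℝ} (hE : hubbardTorus 2 L 1 U *ᵥ ψ = (E : ℂ) • ψ) :
    (groundEnergy (hubbardTorus 2 L 1 U) (2 * n + 1) + groundEnergy (hubbardTorus 2 L 1 U) (2 * n - 1) -
          2 * E) *
        ∑ k : TorusSite 2 L,
          (star (momentumAnnihilation k 0 *ᵥ ψ) ⬝ᵥ (momentumAnnihilation k 0 *ᵥ ψ)).re *
            (1 - (star (momentumAnnihilation k 0 *ᵥ ψ) ⬝ᵥ (momentumAnnihilation k 0 *ᵥ ψ)).re) ≤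
      U * ((n : ℝ) ^ 2 / (L : ℝ) ^ 2 -
        (star ψ ⬝ᵥ ((∑ z : FermionTorus 2 L, numberOp z 0 * numberOp z 1) *ᵥ ψ)).re) := by
  have hsec : IsInSector n n ψ := (mem_szSector_two_mul_zero_iff n ψ).1 hmem
  -- Σ_k n_k = n
  have hsumocc : ∑ k : TorusSite 2 L,
      (star (momentumAnnihilation k 0 *ᵥ ψ) ⬝ᵥ (momentumAnnihilation k 0 *ᵥ ψ)).re = n := by
    have h := sum_re_expect_momentumNumber_up (L := L) hsec
    rw [h1, Complex.one_re, mul_one] at h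
    rw [← h]
    refine Finset.sum_congr rfl fun k _ => ?_
    rw [star_dotProduct_momentumNumber_mulVec]
  -- Σ_k β_k = Re⟨ψ, D ψ⟩
  have hsumβ : ∑ k : TorusSite 2 L,
      (star ψ ⬝ᵥ (((∑ z : FermionTorus 2 L, (torusFourierWeight 2 L * torusChar k z.toTorusSite) •
        (numberOp z 1 * creation (orb z 0))) * momentumAnnihilation k 0) *ᵥ ψ)).re =
      (star ψ ⬝ᵥ ((∑ z : FermionTorus 2 L, numberOp z 0 * numberOp z 1) *ᵥ ψ)).re := by
    rw [← Complex.re_sum, ← dotProduct_sum, ← Matrix.sum_mulVec, sum_dressed_mul_momentumAnnihilation]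
  rw [Finset.mul_sum]
  calc ∑ k : TorusSite 2 L, (groundEnergy (hubbardTorus 2 L 1 U) (2 * n + 1) +
          groundEnergy (hubbardTorus 2 L 1 U) (2 * n - 1) - 2 * E) *
          ((star (momentumAnnihilation k 0 *ᵥ ψ) ⬝ᵥ (momentumAnnihilation k 0 *ᵥ ψ)).re *
            (1 - (star (momentumAnnihilation k 0 *ᵥ ψ) ⬝ᵥ (momentumAnnihilation k 0 *ᵥ ψ)).re))
      ≤ ∑ k : TorusSite 2 L, U * ((n : ℝ) / (L : ℝ) ^ 2 *
          (star (momentumAnnihilation k 0 *ᵥ ψ) ⬝ᵥ (momentumAnnihilation k 0 *ᵥ ψ)).re -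
          (star ψ ⬝ᵥ (((∑ z : FermionTorus 2 L, (torusFourierWeight 2 L * torusChar k z.toTorusSite) •
            (numberOp z 1 * creation (orb z 0))) * momentumAnnihilation k 0) *ᵥ ψ)).re) :=
        Finset.sum_le_sum fun k _ => parityGap_mul_occ_le_mode hL U hmem h1 hE k
    _ = U * ((n : ℝ) / (L : ℝ) ^ 2 * ∑ k : TorusSite 2 L,
          (star (momentumAnnihilation k 0 *ᵥ ψ) ⬝ᵥ (momentumAnnihilation k 0 *ᵥ ψ)).re -
          ∑ k : TorusSite 2 L, (star ψ ⬝ᵥ (((∑ z : FermionTorus 2 L,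
            (torusFourierWeight 2 L * torusChar k z.toTorusSite) •
            (numberOp z 1 * creation (orb z 0))) * momentumAnnihilation k 0) *ᵥ ψ)).re) := by
        rw [← Finset.mul_sum, Finset.sum_sub_distrib, Finset.mul_sum]
    _ = U * ((n : ℝ) ^ 2 / (L : ℝ) ^ 2 -
        (star ψ ⬝ᵥ ((∑ z : FermionTorus 2 L, numberOp z 0 * numberOp z 1) *ᵥ ψ)).re) := by
        rw [hsumocc, hsumβ]
        ring

/-- **The same for a sector ground state, in the currency of the route's items.**  For every real
`U`, `L ≥ 3`, and every unit ground state `ψ` of `hubbardTorus 2 L 1 U` in the sector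
`(2n, S^z = 0)` (`IsGroundStateInSector`):
`(E(2n+1) + E(2n-1) - 2E₀(2n, S^z=0)) · Σ_k n_k(1 - n_k) ≤ U · (n²/L² - Re⟨ψ, Σ_z n_{z↑}n_{z↓} ψ⟩)` —
the Matveev–Larkin parity gap times the momentum smearing of `ψ` is at most the coupling times
its doublon deficit. Matveev–Larkin, PRL 78 (1997) 3749; Tasaki (2020) §2.1, §9.3. [folklore] -/
theorem parityGap_mul_smearing_le_of_isGroundStateInSector (hL : 3 ≤ L) (U : ℝ) {n : ℕ}
    {ψ : Fock (Orb (FermionTorus 2 L))}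
    (hgs : IsGroundStateInSector (hubbardTorus 2 L 1 U) (2 * n) 0 ψ) (h1 : star ψ ⬝ᵥ ψ = 1) :
    (groundEnergy (hubbardTorus 2 L 1 U) (2 * n + 1) + groundEnergy (hubbardTorus 2 L 1 U) (2 * n - 1) -
          2 * (hubbardTorus 2 L 1 U).minEnergyOn (szSector (Λ := FermionTorus 2 L) (2 * n) 0)) *
        ∑ k : TorusSite 2 L,
          (star (momentumAnnihilation k 0 *ᵥ ψ) ⬝ᵥ (momentumAnnihilation k 0 *ᵥ ψ)).re *
            (1 - (star (momentumAnnihilation k 0 *ᵥ ψ) ⬝ᵥ (momentumAnnihilation k 0 *ᵥ ψ)).re) ≤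
      U * ((n : ℝ) ^ 2 / (L : ℝ) ^ 2 -
        (star ψ ⬝ᵥ ((∑ z : FermionTorus 2 L, numberOp z 0 * numberOp z 1) *ᵥ ψ)).re) :=
  parityGap_mul_smearing_le hL U hgs.1 h1 hgs.2.2

/-- The momentum smearing `Σ_k n_k (1 - n_k)` of a unit vector is non-negative (each Bloch
occupation lies in `[0, 1]`). [folklore] -/
theorem smearing_nonneg {ψ : Fock (Orb (FermionTorus 2 L))} (h1 : star ψ ⬝ᵥ ψ = 1) :
    0 ≤ ∑ k : TorusSite 2 L,
      (star (momentumAnnihilation k 0 *ᵥ ψ) ⬝ᵥ (momentumAnnihilation k 0 *ᵥ ψ)).re *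
        (1 - (star (momentumAnnihilation k 0 *ᵥ ψ) ⬝ᵥ (momentumAnnihilation k 0 *ᵥ ψ)).re) := by
  refine Finset.sum_nonneg fun k _ => ?_
  have hmem := re_expect_momentumNumber_mem_Icc k 0 ψ
  rw [star_dotProduct_momentumNumber_mulVec, h1, Complex.one_re] at hmem
  exact mul_nonneg hmem.1 (sub_nonneg.2 hmem.2)

end ModeIdentity

end Literature.MathematicalPhysics.QuantumLattice

end
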